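import Mathlib
import Summits.NavierStokesRegularity.NavierStokesRegularity.Theorems.FilamentSkeletonRssAreaLawSlavingHoloDatumAnalytic

/-!
# Area-law slaving, complex part 16 — ZEROTH ITERATE: the complete area block INCLUDING the analytic conjunct, Γ-uniformly
# (`FilamentSkeletonRss`, child crux `TangentSkeletonNearStraight`, stmt-NavierStokesRegularity-28295, line
# `child_tangent_analytic_strip`, ∃-side of the registered stub `stub_analyticClosing`: the area clauses of `TangentSkeletonAnalytic` at the datum)

One citable statement joining real part 10 (`straightDatum_slavedArea_block`: for the straight skew datum and every `Γ > 0` the rescaled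
slip `w⁰_j = √Γ·W_j(·/√Γ)` carries slaved core areas `Aa⁰` with the area law, the Γ-flat cone bound with a Γ-free `KA`, the floor
`Λ⁻¹ ≤ Aa⁰` and the regular value) with complex part 15 (`straightDatum_stadium_analytic_area`: the same `Aa⁰_j` is
`StadiumAnalyticArea (cs√Γ) L (√Γ s₀_j)` under Γ-free smallness of `cs`): the SAME family `Aa⁰` has all five properties, for every `Γ ≥ 1`.
The analytic clause is stated for each filament `j` and every `cs, L` satisfying the (Γ-free, datum-dependent) smallness conditions of
part 15 and the fit of the near rectangle; the constants `B_j, K₀_j, M₀_j` are the explicit ones of part 15.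

* `straightDatum_area_block_analytic` — the statement.

HONEST FRAMING: bookkeeping about the straight datum of a HYPOTHETICAL filament skeleton on the NEGATIVE side of a MODEL route; no registered
stub is closed by this file and nothing here bears on Navier–Stokes regularity or blow-up.  `--supports stmt-NavierStokesRegularity-28295`.
-/

set_option linter.dupNamespace false

noncomputable section

namespace Summit.NavierStokesRegularity.NavierStokesRegularity.Theorems.AreaLawSlavingHolo

open Set Metric Filter Real Finset
open scoped Topology BigOperators InnerProductSpace
open Literature.Analysis.FluidPDE
open Summit.NavierStokesRegularity.NavierStokesRegularity.Theorems.AreaLawSlaving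

/-- **Zeroth iterate: area law, cone bound, floor, regular value AND stadium-analyticity of the slaved areas, Γ-uniformly.**
See the module docstring. [folklore] -/
theorem straightDatum_area_block_analytic {N : ℕ} {δ ρ Λ Rw θ mw α : ℝ} {p t : Fin N → EuclideanSpace ℝ (Fin 3)}
    {γ : Fin N → ℝ} {s₀ : Fin N → ℝ} (hN : 0 < N) (hδ : 0 < δ) (hρ : 0 < ρ) (hθ : 0 < θ) (hmw : 0 < mw)
    (ht : ∀ j, ‖t j‖ = 1) (hsep : ∀ j k, j ≠ k → ∀ τ σ : ℝ, ρ ≤ ‖(p j + τ • t j) - (p k + σ • t k)‖)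
    (hα : |α| ≤ θ⁻¹) (hγ : ∀ j, |γ j| ≤ θ⁻¹) (hwaist : ∀ j, ‖p j + s₀ j • t j‖ ≤ Rw)
    (W : Fin N → ℝ → ℝ)
    (hW : ∀ j s, W j s = ⟪(∑ k ∈ Finset.univ.erase j, (γ k / (2 * Real.pi)) •
      ((‖(p j + s • t j - p k) - ⟪p j + s • t j - p k, t k⟫_ℝ • t k‖ ^ 2)⁻¹ •
        cross (t k) ((p j + s • t j - p k) - ⟪p j + s • t j - p k, t k⟫_ℝ • t k))) +
      (1 / 2 : ℝ) • (p j + s • t j) - α • cross (EuclideanSpace.single 2 1) (p j + s • t j), t j⟫_ℝ)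
    (hzero : ∀ j, W j (s₀ j) = 0) (hfloorW : ∀ j s, mw * |s - s₀ j| ≤ |W j s|)
    (hsupW : ∀ j, 3 / 2 + δ ≤ deriv (W j) (s₀ j)) (hΛW : ∀ j s, |deriv (W j) s| ≤ Λ)
    (B K₀ M₀ : Fin N → ℝ)
    (hB : ∀ j, B j = ∑ k ∈ Finset.univ.erase j, |γ k / (2 * Real.pi)| *
      (4 * |⟪cross (t k) ((p j - p k) - ⟪p j - p k, t k⟫_ℝ • t k), t j⟫_ℝ| / (3 * ρ ^ 2)))
    (hK₀ : ∀ j, K₀ j = 64 * B j / ρ ^ 2 + 1) (hM₀ : ∀ j, M₀ j = 1 / 2 + 8 * B j / ρ) :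
    ∃ KA : ℝ, 0 < KA ∧ ∀ Γ : ℝ, 1 ≤ Γ →
      ∃ Aa : Fin N → ℝ → ℝ,
        (∀ j, Differentiable ℝ (Aa j) ∧ (∀ τ, 0 < Aa j τ) ∧
          ∀ τ, (√Γ * W j (τ / √Γ)) * deriv (Aa j) τ =
            (3 / 2 - deriv (fun τ => √Γ * W j (τ / √Γ)) τ) * Aa j τ + 4) ∧
        (∀ j τ, Rw ^ 2 * Γ * Aa j τ ≤ KA * (Rw ^ 2 * Γ + ‖√Γ • p j + τ • t j‖ ^ 2)) ∧
        (∀ j τ, Λ⁻¹ ≤ Aa j τ) ∧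
        (∀ j, Aa j (√Γ * s₀ j) = 4 / (deriv (W j) (s₀ j) - 3 / 2)) ∧
        (∀ j (cs L : ℝ), 0 < cs → cs ≤ ρ / 4 → cs * K₀ j ≤ 1 / 8 →
          8 * K₀ j * cs * (18 + 12 * M₀ j + 48 * Λ) ≤ mw → √Γ / (8 * K₀ j) < L + cs * √Γ →
          ∃ G : ℂ → ℂ, DifferentiableOn ℂ G {z : ℂ | |z.im| < cs * √Γ ∧ |z.re - √Γ * s₀ j| < L + cs * √Γ} ∧
            (∀ x : ℝ, (x : ℂ) ∈ {z : ℂ | |z.im| < cs * √Γ ∧ |z.re - √Γ * s₀ j| < L + cs * √Γ} →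
              G x = ((Aa j x : ℝ) : ℂ)) ∧
            ∀ z ∈ {z : ℂ | |z.im| < cs * √Γ ∧ |z.re - √Γ * s₀ j| < L + cs * √Γ},
              Aa j z.re / 2 ≤ (G z).re ∧ ‖G z‖ ≤ 2 * Aa j z.re) := by
  obtain ⟨KA, hKA, hblock⟩ :=
    straightDatum_slavedArea_block hN hδ hρ hθ hmw ht hsep hα hγ hwaist W hW hzero hfloorW hsupW hΛW
  refine ⟨KA, hKA, fun Γ hΓ => ?_⟩
  obtain ⟨Aa, hlaw, hcone, hfl, hreg⟩ := hblock Γ (by linarith)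
  refine ⟨Aa, hlaw, hcone, hfl, hreg, ?_⟩
  intro j cs L hcs hcsρ hs₁ hs₂ hfit
  have hΛ : 0 < Λ := by
    have h1 := hΛW j (s₀ j)
    have h2 := hsupW j
    have h3 := le_abs_self (deriv (W j) (s₀ j))
    linarith
  have hsup : 3 / 2 < deriv (W j) (s₀ j) := by linarith [hsupW j]
  exact straightDatum_stadium_analytic_area hρ ht hsep W hW j (hzero j) hsup hmw (hfloorW j) hΓ hcs hcsρ hΛ (hB j) (hK₀ j)
    (hM₀ j) hs₁ hs₂ hfit (w0 := fun τ => √Γ * W j (τ / √Γ)) (fun τ => rfl) (hlaw j).1 (hlaw j).2.2 (hfl j)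

end Summit.NavierStokesRegularity.NavierStokesRegularity.Theorems.AreaLawSlavingHolo
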